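import Mathlib
import HarnessLib
import Summits.Ventures.LatticeQCDFlow.Exactness.FlowSamplerTranslationCovariance

/-!
# The flow sampler of a gauge-EQUIVARIANT flow is gauge COVARIANT: its kernel commutes with every gauge transformation, so from the hot start (or from the model law) the law of the run is gauge invariant at EVERY step

HONEST FRAMING: exact (Metropolis-corrected) sampling algorithms for lattice gauge theory;
figures of merit are autocorrelation/cost numbers at stated couplings and volumes; no
continuum-physics claim.

Venture `LatticeQCDFlow` (cell pub-lqcd), topic `Exactness`; FANOUT row 10 (`eng-equiv`, engine
`latflow.equiv` / `latflow.flows_jax`: gauge-EQUIVARIANT flows — `IsGaugeEquivariant` is what the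
acceptance suite tests to `1e−10` — proposed from `Haar^⊗` and Metropolis-corrected with
`w = e^{−βS_W}·(J∘Ψ⁻¹)`).  NEW WORK of the cell; nothing is cited as a fact; no number; no
definition is introduced.  Row 10's GEN 4–15 files prove that the layers are gauge equivariant
(`KernelCouplingGaugeEquivariance`, `SpectralCouplingGaugeEquivariance`, `SUNStoutLayerEquivariance`, …)
and that continuous exact Jacobians of equivariant layers are class functions
(`EquivariantJacobianGaugeInvariance.isGaugeInvariant_of_hasJacobian`); the Literature has
`wilsonAction_gaugeTransform` and `WilsonGauge.measurePreserving_gaugeTransform` (product Haar is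
gauge invariant).  With §1 of `FlowSamplerTranslationCovariance` (`conjKernel_flowSampler_eq_self`:
the independence-Metropolis kernel commutes with every symmetry of its data) these give the
SAMPLER-level statement — the flow-sampler twin of row 14's `SU2FTHMCGaugeCovariance`.

## What is typed (`G` compact, `d`, `L ≥ 1` arbitrary; `T` any measurable automorphism presenting `U ↦ U^γ`)

* **`conjKernel_flowSampler_gaugeTransform`** — equivariant `Ψ`, gauge-invariant measurable target
  weight `g` and Jacobian `J`: `conjKernel (indepMH (Ψ_* Haar^⊗) (g·(J∘Ψ⁻¹))) T = indepMH …`;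
* **`conjKernel_wilsonFlowSampler_gaugeTransform`** — Wilson target (any continuous matrix
  representation), CONTINUOUS exact Jacobian, second-countable `G`: the only hypothesis left is
  `IsGaugeEquivariant Ψ`;
* out of equilibrium: `piHaar_map_gaugeTransform` (the hot start is gauge invariant),
  `flowModel_map_gaugeTransform` (so is the model law `Ψ_* Haar^⊗`, the engine's start),
  **`wilsonFlowSampler_law_map_gaugeTransform`** (+ iterate spelling) — from any gauge-invariant
  start the law is gauge invariant at every step — and
  **`integral_wilsonFlowSampler_comp_gaugeTransform`**: `E_t[O(U^γ)] = E_t[O(U)]` for every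
  observable `O`, every `γ`, every `t` (so the run's expectation of `O` equals that of its gauge
  average at every step, not only at equilibrium).  The COLD start `U ≡ 1` is NOT gauge invariant
  (its orbit is the set of pure gauges) and is deliberately absent;
* the `SU(N)` stout flow sampler of `SUNStoutFlowSamplerErgodic` with gauge-invariant coefficients:
  **`conjKernel_stoutFlowSampler_gaugeTransform`**, `stoutFlowSampler_hotStart_law_map_gaugeTransform`,
  `integral_stoutFlowSampler_hotStart_comp_gaugeTransform` (every `N`), and from the Wilson measure at
  ANY coupling `β₀` (the engine's `β`-bootstrapping start; the Literature's
  `wilsonMeasure_map_gaugeTransform_holds`): `integral_stoutFlowSampler_wilsonStart_comp_gaugeTransform`.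

NOT here: charge conjugation / centre symmetry of the flow sampler; any number.
-/

noncomputable section

namespace Summit.Ventures.LatticeQCDFlow.Exactness

open MeasureTheory ProbabilityTheory ProbabilityTheory.Kernel Set
open Literature.MathematicalPhysics.QuantumFieldTheory
open Literature.MathematicalPhysics.QuantumFieldTheory.Luscher2010
open scoped ENNReal Matrix

/-! ## §1 Any compact group: the flow sampler of an equivariant flow commutes with gauge transformations -/

section Gauge

variable {d L : ℕ} [NeZero L] {G : Type*} [Group G] [TopologicalSpace G] [IsTopologicalGroup G]
  [CompactSpace G] [MeasurableSpace G] [BorelSpace G]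

/-- **The hot start `Haar^⊗` is gauge invariant** (`WilsonGauge.measurePreserving_gaugeTransform`, as
an equation of measures). -/
theorem piHaar_map_gaugeTransform (γ : Site d L → G) :
    (Measure.pi fun _ : Edge d L => haarProbability G).map (gaugeTransform γ) =
      Measure.pi fun _ : Edge d L => haarProbability G :=
  (WilsonGauge.measurePreserving_gaugeTransform γ).map_eq

/-- **The model law `Ψ_* Haar^⊗` of a gauge-equivariant flow is gauge invariant** — the engine's
start "accept the first proposal". -/
theorem flowModel_map_gaugeTransform {Ψ : GaugeConfig d L G → GaugeConfig d L G} (hΨm : Measurable Ψ)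
    (hΨ : IsGaugeEquivariant Ψ) (γ : Site d L → G) :
    ((Measure.pi fun _ : Edge d L => haarProbability G).map Ψ).map (gaugeTransform γ) =
      (Measure.pi fun _ : Edge d L => haarProbability G).map Ψ := by
  obtain ⟨T, hT⟩ := exists_measurableEquiv_gaugeTransform (d := d) (L := L) γ
  rw [← hT]
  refine map_map_eq_self_of_comm hΨm T ?_ (fun V => ?_)
  · rw [hT]; exact piHaar_map_gaugeTransform γ
  · rw [hT]; exact hΨ γ V

/-- **A gauge-equivariant flow gives a gauge-covariant flow sampler**: gauge-invariant measurable
target weight `g` and Jacobian `J`, `T` presenting `U ↦ U^γ`: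
`conjKernel (indepMH (Ψ_* Haar^⊗) (g·(J∘Ψ⁻¹))) T = indepMH (Ψ_* Haar^⊗) (g·(J∘Ψ⁻¹))`. -/
theorem conjKernel_flowSampler_gaugeTransform (Ψ : GaugeConfig d L G ≃ᵐ GaugeConfig d L G)
    (hΨ : IsGaugeEquivariant (Ψ : GaugeConfig d L G → GaugeConfig d L G))
    {g J : GaugeConfig d L G → ℝ} (hgm : Measurable g) (hJm : Measurable J)
    (hg : IsGaugeInvariant g) (hJ : IsGaugeInvariant J)
    (γ : Site d L → G) (T : GaugeConfig d L G ≃ᵐ GaugeConfig d L G) (hT : ⇑T = gaugeTransform γ) :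
    haveI : IsProbabilityMeasure ((Measure.pi fun _ : Edge d L => haarProbability G).map Ψ) :=
      Measure.isProbabilityMeasure_map Ψ.measurable.aemeasurable
    conjKernel (indepMH ((Measure.pi fun _ : Edge d L => haarProbability G).map Ψ)
        (fun U => g U * J (Ψ.symm U))) T =
      indepMH ((Measure.pi fun _ : Edge d L => haarProbability G).map Ψ) (fun U => g U * J (Ψ.symm U)) := by
  have hTp : MeasurePreserving T (Measure.pi fun _ : Edge d L => haarProbability G)
      (Measure.pi fun _ : Edge d L => haarProbability G) := by
    rw [show (T : GaugeConfig d L G → GaugeConfig d L G) = gaugeTransform γ from hT]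
    exact WilsonGauge.measurePreserving_gaugeTransform γ
  refine conjKernel_flowSampler_eq_self Ψ T hgm hJm hTp (fun V => ?_) (fun V => ?_) (fun V => ?_)
  · rw [hT]; exact hΨ γ V
  · rw [hT]; exact hg γ V
  · rw [hT]; exact hJ γ V

variable [SecondCountableTopology G] {N : ℕ}

/-- **The WILSON flow sampler of a gauge-equivariant flow with a continuous exact Jacobian is gauge
covariant** — the hypotheses `IsGaugeInvariant g`, `IsGaugeInvariant J` DISCHARGED by
`wilsonAction_gaugeTransform` and `isGaugeInvariant_of_hasJacobian`. -/
theorem conjKernel_wilsonFlowSampler_gaugeTransform (ρ : G →* Matrix (Fin N) (Fin N) ℂ)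
    (hρ : Continuous ρ) (β : ℝ) (Ψ : GaugeConfig d L G ≃ᵐ GaugeConfig d L G)
    (hΨ : IsGaugeEquivariant (Ψ : GaugeConfig d L G → GaugeConfig d L G))
    {J : GaugeConfig d L G → ℝ} (hJc : Continuous J) (hJ0 : ∀ U, 0 ≤ J U)
    (hJac : HasJacobian (Measure.pi fun _ : Edge d L => haarProbability G) Ψ
      (fun U => ENNReal.ofReal (J U)))
    (γ : Site d L → G) (T : GaugeConfig d L G ≃ᵐ GaugeConfig d L G) (hT : ⇑T = gaugeTransform γ) :
    haveI : IsProbabilityMeasure ((Measure.pi fun _ : Edge d L => haarProbability G).map Ψ) :=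
      Measure.isProbabilityMeasure_map Ψ.measurable.aemeasurable
    conjKernel (indepMH ((Measure.pi fun _ : Edge d L => haarProbability G).map Ψ)
        (fun U => Real.exp (-β * wilsonAction ρ U) * J (Ψ.symm U))) T =
      indepMH ((Measure.pi fun _ : Edge d L => haarProbability G).map Ψ)
        (fun U => Real.exp (-β * wilsonAction ρ U) * J (Ψ.symm U)) := by
  obtain ⟨_, -, -, hgm⟩ := wilsonBoltzmann_pinched (d := d) (L := L) ρ hρ β
  exact conjKernel_flowSampler_gaugeTransform Ψ hΨ hgm hJc.measurable
    (fun γ' V => by dsimp only; rw [wilsonAction_gaugeTransform])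
    (isGaugeInvariant_of_hasJacobian hΨ hJc hJ0 hJac) γ T hT

/-! ## §2 Out of equilibrium: gauge-invariant laws along the run; `E_t[O(U^γ)] = E_t[O(U)]` -/

/-- **At every step `t` the law of the Wilson flow-sampler run from a gauge-invariant start is gauge
invariant** (`nHit` spelling; starts: `piHaar_map_gaugeTransform`, `flowModel_map_gaugeTransform`). -/
theorem wilsonFlowSampler_law_map_gaugeTransform (ρ : G →* Matrix (Fin N) (Fin N) ℂ)
    (hρ : Continuous ρ) (β : ℝ) (Ψ : GaugeConfig d L G ≃ᵐ GaugeConfig d L G)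
    (hΨ : IsGaugeEquivariant (Ψ : GaugeConfig d L G → GaugeConfig d L G))
    {J : GaugeConfig d L G → ℝ} (hJc : Continuous J) (hJ0 : ∀ U, 0 ≤ J U)
    (hJac : HasJacobian (Measure.pi fun _ : Edge d L => haarProbability G) Ψ
      (fun U => ENNReal.ofReal (J U)))
    (γ : Site d L → G) {μ₀ : Measure (GaugeConfig d L G)} (hμ₀ : μ₀.map (gaugeTransform γ) = μ₀) (t : ℕ) :
    haveI : IsProbabilityMeasure ((Measure.pi fun _ : Edge d L => haarProbability G).map Ψ) :=
      Measure.isProbabilityMeasure_map Ψ.measurable.aemeasurable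
    (μ₀.bind (nHit (indepMH ((Measure.pi fun _ : Edge d L => haarProbability G).map Ψ)
        (fun U => Real.exp (-β * wilsonAction ρ U) * J (Ψ.symm U))) t)).map (gaugeTransform γ) =
      μ₀.bind (nHit (indepMH ((Measure.pi fun _ : Edge d L => haarProbability G).map Ψ)
        (fun U => Real.exp (-β * wilsonAction ρ U) * J (Ψ.symm U))) t) := by
  obtain ⟨T, hT⟩ := exists_measurableEquiv_gaugeTransform (d := d) (L := L) γ
  rw [← hT] at hμ₀ ⊢
  exact Scoring.map_bind_nHit_eq_self
    (conjKernel_wilsonFlowSampler_gaugeTransform ρ hρ β Ψ hΨ hJc hJ0 hJac γ T hT) hμ₀ t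

/-- The same in the iterate spelling `(· .bind K)^[t] μ₀` of `SUNStoutFlowSamplerErgodic`. -/
theorem wilsonFlowSampler_iterate_law_map_gaugeTransform (ρ : G →* Matrix (Fin N) (Fin N) ℂ)
    (hρ : Continuous ρ) (β : ℝ) (Ψ : GaugeConfig d L G ≃ᵐ GaugeConfig d L G)
    (hΨ : IsGaugeEquivariant (Ψ : GaugeConfig d L G → GaugeConfig d L G))
    {J : GaugeConfig d L G → ℝ} (hJc : Continuous J) (hJ0 : ∀ U, 0 ≤ J U)
    (hJac : HasJacobian (Measure.pi fun _ : Edge d L => haarProbability G) Ψ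
      (fun U => ENNReal.ofReal (J U)))
    (γ : Site d L → G) {μ₀ : Measure (GaugeConfig d L G)} (hμ₀ : μ₀.map (gaugeTransform γ) = μ₀) (t : ℕ) :
    haveI : IsProbabilityMeasure ((Measure.pi fun _ : Edge d L => haarProbability G).map Ψ) :=
      Measure.isProbabilityMeasure_map Ψ.measurable.aemeasurable
    ((fun m : Measure (GaugeConfig d L G) =>
        m.bind (indepMH ((Measure.pi fun _ : Edge d L => haarProbability G).map Ψ)
          (fun U => Real.exp (-β * wilsonAction ρ U) * J (Ψ.symm U))))^[t] μ₀).map (gaugeTransform γ) =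
      (fun m : Measure (GaugeConfig d L G) =>
        m.bind (indepMH ((Measure.pi fun _ : Edge d L => haarProbability G).map Ψ)
          (fun U => Real.exp (-β * wilsonAction ρ U) * J (Ψ.symm U))))^[t] μ₀ := by
  obtain ⟨T, hT⟩ := exists_measurableEquiv_gaugeTransform (d := d) (L := L) γ
  rw [← hT] at hμ₀ ⊢
  exact iterate_bind_map_eq_self_of_conjKernel_eq_self
    (conjKernel_wilsonFlowSampler_gaugeTransform ρ hρ β Ψ hΨ hJc hJ0 hJac γ T hT) hμ₀ t

/-- **`E_t[O(U^γ)] = E_t[O(U)]` at every step**, for every observable `O` (integrable or not — both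
sides are the same junk otherwise), every gauge transformation `γ`, from any gauge-invariant start:
along the run every observable has the expectation of its gauge average. -/
theorem integral_wilsonFlowSampler_comp_gaugeTransform (ρ : G →* Matrix (Fin N) (Fin N) ℂ)
    (hρ : Continuous ρ) (β : ℝ) (Ψ : GaugeConfig d L G ≃ᵐ GaugeConfig d L G)
    (hΨ : IsGaugeEquivariant (Ψ : GaugeConfig d L G → GaugeConfig d L G))
    {J : GaugeConfig d L G → ℝ} (hJc : Continuous J) (hJ0 : ∀ U, 0 ≤ J U)
    (hJac : HasJacobian (Measure.pi fun _ : Edge d L => haarProbability G) Ψ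
      (fun U => ENNReal.ofReal (J U)))
    (γ : Site d L → G) {μ₀ : Measure (GaugeConfig d L G)} (hμ₀ : μ₀.map (gaugeTransform γ) = μ₀) (t : ℕ)
    {F : Type*} [NormedAddCommGroup F] [NormedSpace ℝ F] (O : GaugeConfig d L G → F) :
    haveI : IsProbabilityMeasure ((Measure.pi fun _ : Edge d L => haarProbability G).map Ψ) :=
      Measure.isProbabilityMeasure_map Ψ.measurable.aemeasurable
    ∫ U, O (gaugeTransform γ U) ∂(μ₀.bind (nHit (indepMH
        ((Measure.pi fun _ : Edge d L => haarProbability G).map Ψ)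
        (fun U => Real.exp (-β * wilsonAction ρ U) * J (Ψ.symm U))) t)) =
      ∫ U, O U ∂(μ₀.bind (nHit (indepMH
        ((Measure.pi fun _ : Edge d L => haarProbability G).map Ψ)
        (fun U => Real.exp (-β * wilsonAction ρ U) * J (Ψ.symm U))) t)) := by
  obtain ⟨T, hT⟩ := exists_measurableEquiv_gaugeTransform (d := d) (L := L) γ
  have hμ₀' : μ₀.map T = μ₀ := by rw [hT]; exact hμ₀
  have h := (MeasurePreserving.mk T.measurable (Scoring.map_bind_nHit_eq_self
    (conjKernel_wilsonFlowSampler_gaugeTransform ρ hρ β Ψ hΨ hJc hJ0 hJac γ T hT) hμ₀' t)).integral_comp' O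
  rw [hT] at h
  exact h

end Gauge

/-! ## §3 The `SU(N)` stout flow sampler of `SUNStoutFlowSamplerErgodic` -/

section Stout

variable {d L n : ℕ} [NeZero L]

/-- **The `SU(N)` stout-flow sampler for the Wilson action is gauge covariant** (every `N`, `d`, `L`;
gauge-invariant coefficient field `ρ` — a conditioner reading traces of closed loops, or constants;
`Ψ` the masked stout step as a measurable automorphism; `J ≥ 0` any CONTINUOUS exact Jacobian of it):
`conjKernel K T = K` for every `T` presenting a gauge transformation and
`K = indepMH (Ψ_* Haar^⊗) (e^{−βS_W}·(J∘Ψ⁻¹))`. -/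
theorem conjKernel_stoutFlowSampler_gaugeTransform {N : ℕ}
    (ρW : Matrix.specialUnitaryGroup (Fin n) ℂ →* Matrix (Fin N) (Fin N) ℂ) (hρW : Continuous ρW) (β : ℝ)
    (p : Edge d L → Prop) [DecidablePred p]
    (ρ : GaugeConfig d L (Matrix.specialUnitaryGroup (Fin n) ℂ) → Edge d L → ℝ)
    (hρ : ∀ (g : Site d L → Matrix.specialUnitaryGroup (Fin n) ℂ)
      (V : GaugeConfig d L (Matrix.specialUnitaryGroup (Fin n) ℂ)) (e : Edge d L), p e →
        ρ (gaugeTransform g V) e = ρ V e)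
    (Ψ : GaugeConfig d L (Matrix.specialUnitaryGroup (Fin n) ℂ) ≃ᵐ
      GaugeConfig d L (Matrix.specialUnitaryGroup (Fin n) ℂ))
    (hΨ : ⇑Ψ = fun (V : GaugeConfig d L (Matrix.specialUnitaryGroup (Fin n) ℂ)) (e : Edge d L) =>
      if p e then
        (⟨NormedSpace.exp ((ρ V e : ℂ) • suProj (plaquetteLoopSum V e.1 e.2)),
            exp_smul_suProj_mem (ρ V e) (plaquetteLoopSum V e.1 e.2)⟩ :
          Matrix.specialUnitaryGroup (Fin n) ℂ) * V e
      else V e)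
    {J : GaugeConfig d L (Matrix.specialUnitaryGroup (Fin n) ℂ) → ℝ} (hJc : Continuous J)
    (hJ0 : ∀ U, 0 ≤ J U)
    (hJac : HasJacobian (Measure.pi fun _ : Edge d L => haarProbability (Matrix.specialUnitaryGroup (Fin n) ℂ))
      Ψ (fun U => ENNReal.ofReal (J U)))
    (γ : Site d L → Matrix.specialUnitaryGroup (Fin n) ℂ)
    (T : GaugeConfig d L (Matrix.specialUnitaryGroup (Fin n) ℂ) ≃ᵐ
      GaugeConfig d L (Matrix.specialUnitaryGroup (Fin n) ℂ)) (hT : ⇑T = gaugeTransform γ) :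
    haveI : IsProbabilityMeasure
        ((Measure.pi fun _ : Edge d L => haarProbability (Matrix.specialUnitaryGroup (Fin n) ℂ)).map Ψ) :=
      Measure.isProbabilityMeasure_map Ψ.measurable.aemeasurable
    conjKernel (indepMH ((Measure.pi fun _ : Edge d L =>
          haarProbability (Matrix.specialUnitaryGroup (Fin n) ℂ)).map Ψ)
        (fun U => Real.exp (-β * wilsonAction ρW U) * J (Ψ.symm U))) T =
      indepMH ((Measure.pi fun _ : Edge d L =>
          haarProbability (Matrix.specialUnitaryGroup (Fin n) ℂ)).map Ψ)
        (fun U => Real.exp (-β * wilsonAction ρW U) * J (Ψ.symm U)) := by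
  haveI : SecondCountableTopology (Matrix (Fin n) (Fin n) ℂ) :=
    inferInstanceAs (SecondCountableTopology (Fin n → Fin n → ℂ))
  haveI : SecondCountableTopology (Matrix.specialUnitaryGroup (Fin n) ℂ) :=
    Topology.IsEmbedding.subtypeVal.secondCountableTopology
  have hequiv : IsGaugeEquivariant (Ψ : GaugeConfig d L (Matrix.specialUnitaryGroup (Fin n) ℂ) →
      GaugeConfig d L (Matrix.specialUnitaryGroup (Fin n) ℂ)) := by
    rw [hΨ]
    exact isGaugeEquivariant_sunStoutLayer p ρ hρ
  exact conjKernel_wilsonFlowSampler_gaugeTransform ρW hρW β Ψ hequiv hJc hJ0 hJac γ T hT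

/-- **Hot start: the law of the `SU(N)` stout-flow-sampler run is gauge invariant at every step.** -/
theorem stoutFlowSampler_hotStart_law_map_gaugeTransform {N : ℕ}
    (ρW : Matrix.specialUnitaryGroup (Fin n) ℂ →* Matrix (Fin N) (Fin N) ℂ) (hρW : Continuous ρW) (β : ℝ)
    (p : Edge d L → Prop) [DecidablePred p]
    (ρ : GaugeConfig d L (Matrix.specialUnitaryGroup (Fin n) ℂ) → Edge d L → ℝ)
    (hρ : ∀ (g : Site d L → Matrix.specialUnitaryGroup (Fin n) ℂ)
      (V : GaugeConfig d L (Matrix.specialUnitaryGroup (Fin n) ℂ)) (e : Edge d L), p e →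
        ρ (gaugeTransform g V) e = ρ V e)
    (Ψ : GaugeConfig d L (Matrix.specialUnitaryGroup (Fin n) ℂ) ≃ᵐ
      GaugeConfig d L (Matrix.specialUnitaryGroup (Fin n) ℂ))
    (hΨ : ⇑Ψ = fun (V : GaugeConfig d L (Matrix.specialUnitaryGroup (Fin n) ℂ)) (e : Edge d L) =>
      if p e then
        (⟨NormedSpace.exp ((ρ V e : ℂ) • suProj (plaquetteLoopSum V e.1 e.2)),
            exp_smul_suProj_mem (ρ V e) (plaquetteLoopSum V e.1 e.2)⟩ :
          Matrix.specialUnitaryGroup (Fin n) ℂ) * V e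
      else V e)
    {J : GaugeConfig d L (Matrix.specialUnitaryGroup (Fin n) ℂ) → ℝ} (hJc : Continuous J)
    (hJ0 : ∀ U, 0 ≤ J U)
    (hJac : HasJacobian (Measure.pi fun _ : Edge d L => haarProbability (Matrix.specialUnitaryGroup (Fin n) ℂ))
      Ψ (fun U => ENNReal.ofReal (J U)))
    (γ : Site d L → Matrix.specialUnitaryGroup (Fin n) ℂ) (t : ℕ) :
    haveI : IsProbabilityMeasure
        ((Measure.pi fun _ : Edge d L => haarProbability (Matrix.specialUnitaryGroup (Fin n) ℂ)).map Ψ) :=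
      Measure.isProbabilityMeasure_map Ψ.measurable.aemeasurable
    ((Measure.pi fun _ : Edge d L => haarProbability (Matrix.specialUnitaryGroup (Fin n) ℂ)).bind
        (nHit (indepMH ((Measure.pi fun _ : Edge d L =>
            haarProbability (Matrix.specialUnitaryGroup (Fin n) ℂ)).map Ψ)
          (fun U => Real.exp (-β * wilsonAction ρW U) * J (Ψ.symm U))) t)).map (gaugeTransform γ) =
      (Measure.pi fun _ : Edge d L => haarProbability (Matrix.specialUnitaryGroup (Fin n) ℂ)).bind
        (nHit (indepMH ((Measure.pi fun _ : Edge d L =>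
            haarProbability (Matrix.specialUnitaryGroup (Fin n) ℂ)).map Ψ)
          (fun U => Real.exp (-β * wilsonAction ρW U) * J (Ψ.symm U))) t) := by
  haveI : SecondCountableTopology (Matrix (Fin n) (Fin n) ℂ) :=
    inferInstanceAs (SecondCountableTopology (Fin n → Fin n → ℂ))
  haveI : SecondCountableTopology (Matrix.specialUnitaryGroup (Fin n) ℂ) :=
    Topology.IsEmbedding.subtypeVal.secondCountableTopology
  have hequiv : IsGaugeEquivariant (Ψ : GaugeConfig d L (Matrix.specialUnitaryGroup (Fin n) ℂ) →
      GaugeConfig d L (Matrix.specialUnitaryGroup (Fin n) ℂ)) := by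
    rw [hΨ]
    exact isGaugeEquivariant_sunStoutLayer p ρ hρ
  exact wilsonFlowSampler_law_map_gaugeTransform ρW hρW β Ψ hequiv hJc hJ0 hJac γ
    (piHaar_map_gaugeTransform γ) t

/-- **Hot start: `E_t[O(U^γ)] = E_t[O(U)]` along the `SU(N)` stout-flow-sampler run**, every
observable, every gauge transformation, every step. -/
theorem integral_stoutFlowSampler_hotStart_comp_gaugeTransform {N : ℕ}
    (ρW : Matrix.specialUnitaryGroup (Fin n) ℂ →* Matrix (Fin N) (Fin N) ℂ) (hρW : Continuous ρW) (β : ℝ)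
    (p : Edge d L → Prop) [DecidablePred p]
    (ρ : GaugeConfig d L (Matrix.specialUnitaryGroup (Fin n) ℂ) → Edge d L → ℝ)
    (hρ : ∀ (g : Site d L → Matrix.specialUnitaryGroup (Fin n) ℂ)
      (V : GaugeConfig d L (Matrix.specialUnitaryGroup (Fin n) ℂ)) (e : Edge d L), p e →
        ρ (gaugeTransform g V) e = ρ V e)
    (Ψ : GaugeConfig d L (Matrix.specialUnitaryGroup (Fin n) ℂ) ≃ᵐ
      GaugeConfig d L (Matrix.specialUnitaryGroup (Fin n) ℂ))
    (hΨ : ⇑Ψ = fun (V : GaugeConfig d L (Matrix.specialUnitaryGroup (Fin n) ℂ)) (e : Edge d L) =>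
      if p e then
        (⟨NormedSpace.exp ((ρ V e : ℂ) • suProj (plaquetteLoopSum V e.1 e.2)),
            exp_smul_suProj_mem (ρ V e) (plaquetteLoopSum V e.1 e.2)⟩ :
          Matrix.specialUnitaryGroup (Fin n) ℂ) * V e
      else V e)
    {J : GaugeConfig d L (Matrix.specialUnitaryGroup (Fin n) ℂ) → ℝ} (hJc : Continuous J)
    (hJ0 : ∀ U, 0 ≤ J U)
    (hJac : HasJacobian (Measure.pi fun _ : Edge d L => haarProbability (Matrix.specialUnitaryGroup (Fin n) ℂ))
      Ψ (fun U => ENNReal.ofReal (J U)))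
    (γ : Site d L → Matrix.specialUnitaryGroup (Fin n) ℂ) (t : ℕ)
    {F : Type*} [NormedAddCommGroup F] [NormedSpace ℝ F]
    (O : GaugeConfig d L (Matrix.specialUnitaryGroup (Fin n) ℂ) → F) :
    haveI : IsProbabilityMeasure
        ((Measure.pi fun _ : Edge d L => haarProbability (Matrix.specialUnitaryGroup (Fin n) ℂ)).map Ψ) :=
      Measure.isProbabilityMeasure_map Ψ.measurable.aemeasurable
    ∫ U, O (gaugeTransform γ U) ∂((Measure.pi fun _ : Edge d L =>
        haarProbability (Matrix.specialUnitaryGroup (Fin n) ℂ)).bind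
        (nHit (indepMH ((Measure.pi fun _ : Edge d L =>
            haarProbability (Matrix.specialUnitaryGroup (Fin n) ℂ)).map Ψ)
          (fun U => Real.exp (-β * wilsonAction ρW U) * J (Ψ.symm U))) t)) =
      ∫ U, O U ∂((Measure.pi fun _ : Edge d L =>
        haarProbability (Matrix.specialUnitaryGroup (Fin n) ℂ)).bind
        (nHit (indepMH ((Measure.pi fun _ : Edge d L =>
            haarProbability (Matrix.specialUnitaryGroup (Fin n) ℂ)).map Ψ)
          (fun U => Real.exp (-β * wilsonAction ρW U) * J (Ψ.symm U))) t)) := by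
  haveI : SecondCountableTopology (Matrix (Fin n) (Fin n) ℂ) :=
    inferInstanceAs (SecondCountableTopology (Fin n → Fin n → ℂ))
  haveI : SecondCountableTopology (Matrix.specialUnitaryGroup (Fin n) ℂ) :=
    Topology.IsEmbedding.subtypeVal.secondCountableTopology
  have hequiv : IsGaugeEquivariant (Ψ : GaugeConfig d L (Matrix.specialUnitaryGroup (Fin n) ℂ) →
      GaugeConfig d L (Matrix.specialUnitaryGroup (Fin n) ℂ)) := by
    rw [hΨ]
    exact isGaugeEquivariant_sunStoutLayer p ρ hρ
  exact integral_wilsonFlowSampler_comp_gaugeTransform ρW hρW β Ψ hequiv hJc hJ0 hJac γ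
    (piHaar_map_gaugeTransform γ) t O

/-- **β-bootstrap / warm start: `E_t[O(U^γ)] = E_t[O(U)]` along the `SU(N)` stout-flow-sampler run
started from the Wilson measure at ANY coupling `β₀`** (the Literature's
`wilsonMeasure_map_gaugeTransform_holds` supplies the gauge-invariant start). -/
theorem integral_stoutFlowSampler_wilsonStart_comp_gaugeTransform {N : ℕ}
    (ρW : Matrix.specialUnitaryGroup (Fin n) ℂ →* Matrix (Fin N) (Fin N) ℂ) (hρW : Continuous ρW) (β β₀ : ℝ)
    (p : Edge d L → Prop) [DecidablePred p]
    (ρ : GaugeConfig d L (Matrix.specialUnitaryGroup (Fin n) ℂ) → Edge d L → ℝ)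
    (hρ : ∀ (g : Site d L → Matrix.specialUnitaryGroup (Fin n) ℂ)
      (V : GaugeConfig d L (Matrix.specialUnitaryGroup (Fin n) ℂ)) (e : Edge d L), p e →
        ρ (gaugeTransform g V) e = ρ V e)
    (Ψ : GaugeConfig d L (Matrix.specialUnitaryGroup (Fin n) ℂ) ≃ᵐ
      GaugeConfig d L (Matrix.specialUnitaryGroup (Fin n) ℂ))
    (hΨ : ⇑Ψ = fun (V : GaugeConfig d L (Matrix.specialUnitaryGroup (Fin n) ℂ)) (e : Edge d L) =>
      if p e then
        (⟨NormedSpace.exp ((ρ V e : ℂ) • suProj (plaquetteLoopSum V e.1 e.2)),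
            exp_smul_suProj_mem (ρ V e) (plaquetteLoopSum V e.1 e.2)⟩ :
          Matrix.specialUnitaryGroup (Fin n) ℂ) * V e
      else V e)
    {J : GaugeConfig d L (Matrix.specialUnitaryGroup (Fin n) ℂ) → ℝ} (hJc : Continuous J)
    (hJ0 : ∀ U, 0 ≤ J U)
    (hJac : HasJacobian (Measure.pi fun _ : Edge d L => haarProbability (Matrix.specialUnitaryGroup (Fin n) ℂ))
      Ψ (fun U => ENNReal.ofReal (J U)))
    (γ : Site d L → Matrix.specialUnitaryGroup (Fin n) ℂ) (t : ℕ)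
    {F : Type*} [NormedAddCommGroup F] [NormedSpace ℝ F]
    (O : GaugeConfig d L (Matrix.specialUnitaryGroup (Fin n) ℂ) → F) :
    haveI : IsProbabilityMeasure
        ((Measure.pi fun _ : Edge d L => haarProbability (Matrix.specialUnitaryGroup (Fin n) ℂ)).map Ψ) :=
      Measure.isProbabilityMeasure_map Ψ.measurable.aemeasurable
    ∫ U, O (gaugeTransform γ U) ∂((wilsonMeasure (d := d) (L := L) ρW β₀).bind
        (nHit (indepMH ((Measure.pi fun _ : Edge d L =>
            haarProbability (Matrix.specialUnitaryGroup (Fin n) ℂ)).map Ψ)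
          (fun U => Real.exp (-β * wilsonAction ρW U) * J (Ψ.symm U))) t)) =
      ∫ U, O U ∂((wilsonMeasure (d := d) (L := L) ρW β₀).bind
        (nHit (indepMH ((Measure.pi fun _ : Edge d L =>
            haarProbability (Matrix.specialUnitaryGroup (Fin n) ℂ)).map Ψ)
          (fun U => Real.exp (-β * wilsonAction ρW U) * J (Ψ.symm U))) t)) := by
  haveI : SecondCountableTopology (Matrix (Fin n) (Fin n) ℂ) :=
    inferInstanceAs (SecondCountableTopology (Fin n → Fin n → ℂ))
  haveI : SecondCountableTopology (Matrix.specialUnitaryGroup (Fin n) ℂ) :=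
    Topology.IsEmbedding.subtypeVal.secondCountableTopology
  have hequiv : IsGaugeEquivariant (Ψ : GaugeConfig d L (Matrix.specialUnitaryGroup (Fin n) ℂ) →
      GaugeConfig d L (Matrix.specialUnitaryGroup (Fin n) ℂ)) := by
    rw [hΨ]
    exact isGaugeEquivariant_sunStoutLayer p ρ hρ
  exact integral_wilsonFlowSampler_comp_gaugeTransform ρW hρW β Ψ hequiv hJc hJ0 hJac γ
    (wilsonMeasure_map_gaugeTransform_holds ρW β₀ γ) t O

end Stout

end Summit.Ventures.LatticeQCDFlow.Exactness

end
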